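import Summits.BirchSwinnertonDyer.BirchSwinnertonDyer.Theorems.AdditiveBranchIMCGenusKolyvaginTwistCongruencePrelims
import HarnessLib

/-!
# Crux `GordTwoRankZeroOffCaseOne` (+ twin `MultLower`), line `three_field_road`: the TRANSPORT of the congruence
# label (B5) along the genus twist `Θ_ϑ : E′ ≅ Wd` at a place over an odd good prime `ℓ`, with the sign `(d/ℓ)`

Cell `bsd-addord`, lead seat `cruxlead-19357` (g2); HELPER for the registered stub `stub_genusKolyvaginPointsR[M]`
(`Cruxes/GordTwoRankZeroOffCaseOne/Lines/three_field_road.lean`, `Cruxes/MultLower/Lines/tame_roads_mult.lean`;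
lead report 4 §2, G4 "reduction sign"), landed `--supports … --as helper`. THEOREMS ONLY (no definition, no named
fact, no `sorry`). Sequel of `…GenusKolyvaginTwistCongruencePrelims` (p671233).

## What

* `twistChange_integral` — at a valuation subring `O` of `L ∋ ϑ = √d` with `ℓ ∈ 𝔪_O`, `ℓ` odd,
  `ℓ ∤ d·Δ_min(E′)·Δ_min(Wd)` (`E′`, `Wd = C₂ • (D • E′)^{(d)}` globally minimal over `ℚ`): the rational numbers
  `A, R, B, S, C, T₀` with `T_{±ϑ} = (A(±ϑ)⁻¹, R, B(±ϑ) + S, C(±ϑ) + T₀)` satisfy `|A| = 1`, `R, B, S, C, T₀ ∈ O`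
  — Silverman VII.1.3 (b) (tree `VariableChange.v_r/s/t_le_one_of_isIntegral`) for the two `O`-integral models
  with unit discriminants, applied to BOTH roots and separated into even/odd parts (`2`, `ϑ` are `O`-units).
* **`frobCongruentModPlace_twist`** — if `P ≡ Frob_ℓ(P₀)` on `E′` modulo a valuation subring `𝒪 ∋ ℓ` of a field
  `Ω` under `e : L → Ω` (`FrobCongruentModPlace`, the currency of `Nekovar2007.cmPoint_frobeniusCongruence` and
  `GrossLMS1991.prop37_2_frobeniusCongruence`), then `Θ_ϑ(P) ≡ Frob_ℓ(Θ_{ϑ′}(P₀))` on `Wd` for the roots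
  `ϑ = (d/ℓ)·ϑ′`: the residues of `A^{±1}, R, B, S, C, T₀` are Frobenius-fixed (rationals) and `ϑ̄′^ℓ = (d/ℓ)ϑ̄′ = ϑ̄`
  (Euler), so the `ℓ`-power map carries the residue of `T_{ϑ′}(x₀, y₀)` to that of `T_ϑ(x, y)`; non-integral
  abscissae stay non-integral. For the genus family `y″(m) = Θ_{χ_{d₁}(m)θ}(y_{E′}(m))` and a Kolyvagin prime
  `ℓ ∣ m` this is label (B5) on `Wd` from (B5) on `E′`, since `χ_{d₁}(m) = (d₁/ℓ)·χ_{d₁}(m/ℓ)`.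

HONEST FRAMING: local algebra (Silverman III.1, VII.1–2, X.5; Euler's criterion); nothing about Heegner points or BSD
is asserted here; no stub is closed by this file alone. BSD is not proved by any of this.
[cite: SilvermanAEC2009, III.1 Table 3.1, VII.1 Prop. 1.3 (b), VII.2 Prop. 2.1, X.5 Cor. 5.4 (iii)]
[cite: GrossLMS1991, Prop. 3.7 (2) and proof of Prop. 6.2 (2) (the congruence being transported)]
[cite: IrelandRosen1990, Prop. 5.1.2 (Euler's criterion)]
presearch: n/a (kernel algebra; `lean search 'FrobCongruentModPlace.*twist|twistChange'` → only the prelims file).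
-/

noncomputable section

open scoped Classical

set_option linter.dupNamespace false
set_option autoImplicit false

namespace Summit.BirchSwinnertonDyer.BirchSwinnertonDyer.Theorems.GenusKolyvagin

open WeierstrassCurve Literature.NumberTheory.EllipticCurves IsLocalRing

universe v

/-! ## §5 Integrality of `T_ϑ` at a good odd prime and the transport of the congruence -/

section Main

variable (E' : WeierstrassCurve ℚ) [E'.IsGloballyMinimal] (D C₂ : VariableChange ℚ) (d : ℤ)
  {L : Type v} [Field L] [Algebra ℚ L]

/-- `E′_L` is `O`-integral for every valuation subring `O` of `L` (integer coefficients). [folklore] -/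
theorem isIntegral_baseChange_of_isGloballyMinimal (O : ValuationSubring L) (W : WeierstrassCurve ℚ)
    [W.IsGloballyMinimal] : (W.baseChange L).IsIntegral O := by
  refine ⟨(integralModelInt W).map (Int.castRingHom O), ?_⟩
  show W.map (algebraMap ℚ L) = ((integralModelInt W).map (Int.castRingHom O)).map (algebraMap O L)
  rw [WeierstrassCurve.map_map]
  conv_lhs => rw [← map_integralModelInt W, WeierstrassCurve.map_map]
  congr 1
  exact RingHom.ext_int _ _

/-- The discriminant of `W_L` is the (image of the) minimal discriminant. [folklore] -/
theorem Δ_baseChange_eq_intCast (W : WeierstrassCurve ℚ) [W.IsGloballyMinimal] :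
    (W.baseChange L).Δ = ((minimalDiscriminantInt W : ℤ) : L) := by
  show (W.map (algebraMap ℚ L)).Δ = _
  rw [WeierstrassCurve.map_Δ, ← cast_minimalDiscriminantInt, map_intCast]

variable {E' D C₂ d}

/-- **Integrality of the transport at a good odd prime** (Silverman VII.1.3 (b) at the place `O`, for the
two changes of variables `T_{±ϑ}` between the `O`-integral models `E′_L`, `Wd_L` with `O`-unit
discriminants): the rational numbers `A, R, B, S, C, T₀` of `twistChange_coeff` satisfy `|A| = 1` and
`R, B, S, C, T₀ ∈ O`. [cite: SilvermanAEC2009, Prop. VII.1.3 (b)] -/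
theorem twistChange_integral [CharZero L] [(D • E').IsCharNeTwoNF]
    [(C₂ • (D • E').quadraticTwist (d : ℚ)).IsGloballyMinimal] (O : ValuationSubring L)
    {ℓ : ℕ} [Fact ℓ.Prime] (hℓ2 : ℓ ≠ 2) (hℓO : (ℓ : L) ∈ O.nonunits) (hℓd : ¬ (ℓ : ℤ) ∣ d)
    (hℓE : ¬ (ℓ : ℤ) ∣ minimalDiscriminantInt E')
    (hℓW : ¬ (ℓ : ℤ) ∣ minimalDiscriminantInt (C₂ • (D • E').quadraticTwist (d : ℚ)))
    {ϑ : L} (hϑ2 : ϑ ^ 2 = algebraMap ℚ L (d : ℚ)) (hϑ : ϑ ≠ 0) :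
    O.valuation (algebraMap ℚ L ((C₂.u : ℚ) * D.u)) = 1 ∧
      algebraMap ℚ L (C₂.r * (D.u : ℚ) ^ 2 / d + D.r) ∈ O ∧
      algebraMap ℚ L ((D.u : ℚ) * C₂.s / d) ∈ O ∧ algebraMap ℚ L D.s ∈ O ∧
      algebraMap ℚ L (C₂.t * (D.u : ℚ) ^ 3 / d ^ 2) ∈ O ∧
      algebraMap ℚ L (C₂.r * D.s * (D.u : ℚ) ^ 2 / d + D.t) ∈ O := by
  have hℓ : ℓ.Prime := Fact.out
  have hϑ2' : ϑ ^ 2 = (d : L) := by rw [hϑ2, map_intCast]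
  have hnϑ2' : (-ϑ) ^ 2 = (d : L) := by rw [neg_sq, hϑ2']
  have hnϑ2 : (-ϑ) ^ 2 = algebraMap ℚ L (d : ℚ) := by rw [neg_sq, hϑ2]
  have hnϑ : -ϑ ≠ 0 := neg_ne_zero.mpr hϑ
  have hvϑ := valuation_sqrt_eq_one O hℓO hℓd hϑ2'
  have hϑO := sqrt_mem O hℓO hℓd hϑ2'
  have hϑiO := sqrt_inv_mem O hℓO hℓd hϑ2'
  have hV : ∀ x : L, O.valuation x ≤ 1 ↔ x ∈ (algebraMap O L).range := fun x => by
    rw [O.valuation_le_one_iff]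
    exact ⟨fun hx => ⟨⟨x, hx⟩, rfl⟩, fun ⟨y, hy⟩ => hy ▸ y.2⟩
  haveI : (E'.baseChange L).IsIntegral O := isIntegral_baseChange_of_isGloballyMinimal O E'
  -- the two changes of variables and their targets
  have key : ∀ {θ : L} (hθ2 : θ ^ 2 = algebraMap ℚ L (d : ℚ)) (hθ : θ ≠ 0),
      O.valuation ((C₂.map (algebraMap ℚ L) * ((untwistAt hθ)⁻¹ * D.map (algebraMap ℚ L))).u : L) = 1 ∧
      (C₂.map (algebraMap ℚ L) * ((untwistAt hθ)⁻¹ * D.map (algebraMap ℚ L))).r ∈ O ∧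
      (C₂.map (algebraMap ℚ L) * ((untwistAt hθ)⁻¹ * D.map (algebraMap ℚ L))).s ∈ O ∧
      (C₂.map (algebraMap ℚ L) * ((untwistAt hθ)⁻¹ * D.map (algebraMap ℚ L))).t ∈ O := by
    intro θ hθ2 hθ
    set T := C₂.map (algebraMap ℚ L) * ((untwistAt hθ)⁻¹ * D.map (algebraMap ℚ L)) with hT
    have hTs := twistChange_smul E' D C₂ d hθ2 hθ
    haveI : (T • E'.baseChange L).IsIntegral O := by
      rw [hTs]; exact isIntegral_baseChange_of_isGloballyMinimal O _
    have hu : O.valuation (T.u : L) = 1 := by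
      have hΔ := (E'.baseChange L).variableChange_Δ T
      rw [hTs, Δ_baseChange_eq_intCast, Δ_baseChange_eq_intCast] at hΔ
      have h1 := valuation_intCast_eq_one O hℓ hℓO hℓW
      rw [hΔ, map_mul, map_pow, valuation_intCast_eq_one O hℓ hℓO hℓE, mul_one,
        Units.val_inv_eq_inv_val, map_inv₀] at h1
      have h2 : (O.valuation (T.u : L))⁻¹ = 1 := by
        rcases pow_eq_one_iff.mp h1 with h | h
        · exact h
        · norm_num at h
      exact inv_eq_one.mp h2
    exact ⟨hu,
      (O.valuation_le_one_iff _).mp (VariableChange.v_r_le_one_of_isIntegral hV (E'.baseChange L) T hu),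
      (O.valuation_le_one_iff _).mp (VariableChange.v_s_le_one_of_isIntegral hV (E'.baseChange L) T hu),
      (O.valuation_le_one_iff _).mp (VariableChange.v_t_le_one_of_isIntegral hV (E'.baseChange L) T hu)⟩
  obtain ⟨huP, hrP, hsP, htP⟩ := key hϑ2 hϑ
  obtain ⟨-, -, hsM, htM⟩ := key hnϑ2 hnϑ
  obtain ⟨cu, cr, cs, ct⟩ := twistChange_coeff D C₂ d hϑ2 hϑ
  obtain ⟨-, -, cs', ct'⟩ := twistChange_coeff D C₂ d hnϑ2 hnϑ
  rw [cu, map_mul, map_inv₀, hvϑ, inv_one, mul_one] at huP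
  rw [cr] at hrP
  rw [cs] at hsP
  rw [ct] at htP
  rw [cs', mul_neg] at hsM
  rw [ct', mul_neg] at htM
  -- `2` is a unit of `O`
  have h2 : O.valuation (2 : L) = 1 := by
    have := valuation_intCast_eq_one O hℓ hℓO (n := 2) (fun h => hℓ2 ((Nat.prime_dvd_prime_iff_eq hℓ
      Nat.prime_two).mp (by exact_mod_cast h)))
    simpa using this
  have h2i : (2 : L)⁻¹ ∈ O := (O.valuation_le_one_iff _).mp (by rw [map_inv₀, h2, inv_one])
  have h20 : (2 : L) ≠ 0 := two_ne_zero
  -- even / odd parts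
  have hS : algebraMap ℚ L D.s ∈ O := by
    have : algebraMap ℚ L D.s = (2 : L)⁻¹ * ((algebraMap ℚ L ((D.u : ℚ) * C₂.s / d) * ϑ +
        algebraMap ℚ L D.s) + (-(algebraMap ℚ L ((D.u : ℚ) * C₂.s / d) * ϑ) + algebraMap ℚ L D.s)) := by
      field_simp; ring
    rw [this]; exact mul_mem h2i (add_mem hsP hsM)
  have hB : algebraMap ℚ L ((D.u : ℚ) * C₂.s / d) ∈ O := by
    have : algebraMap ℚ L ((D.u : ℚ) * C₂.s / d) = (2 : L)⁻¹ * ϑ⁻¹ *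
        ((algebraMap ℚ L ((D.u : ℚ) * C₂.s / d) * ϑ + algebraMap ℚ L D.s) -
          (-(algebraMap ℚ L ((D.u : ℚ) * C₂.s / d) * ϑ) + algebraMap ℚ L D.s)) := by
      field_simp; ring
    rw [this]; exact mul_mem (mul_mem h2i hϑiO) (sub_mem hsP hsM)
  have hT : algebraMap ℚ L (C₂.r * D.s * (D.u : ℚ) ^ 2 / d + D.t) ∈ O := by
    have : algebraMap ℚ L (C₂.r * D.s * (D.u : ℚ) ^ 2 / d + D.t) = (2 : L)⁻¹ *
        ((algebraMap ℚ L (C₂.t * (D.u : ℚ) ^ 3 / d ^ 2) * ϑ +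
          algebraMap ℚ L (C₂.r * D.s * (D.u : ℚ) ^ 2 / d + D.t)) +
        (-(algebraMap ℚ L (C₂.t * (D.u : ℚ) ^ 3 / d ^ 2) * ϑ) +
          algebraMap ℚ L (C₂.r * D.s * (D.u : ℚ) ^ 2 / d + D.t))) := by
      field_simp; ring
    rw [this]; exact mul_mem h2i (add_mem htP htM)
  have hC : algebraMap ℚ L (C₂.t * (D.u : ℚ) ^ 3 / d ^ 2) ∈ O := by
    have : algebraMap ℚ L (C₂.t * (D.u : ℚ) ^ 3 / d ^ 2) = (2 : L)⁻¹ * ϑ⁻¹ *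
        ((algebraMap ℚ L (C₂.t * (D.u : ℚ) ^ 3 / d ^ 2) * ϑ +
          algebraMap ℚ L (C₂.r * D.s * (D.u : ℚ) ^ 2 / d + D.t)) -
        (-(algebraMap ℚ L (C₂.t * (D.u : ℚ) ^ 3 / d ^ 2) * ϑ) +
          algebraMap ℚ L (C₂.r * D.s * (D.u : ℚ) ^ 2 / d + D.t))) := by
      field_simp; ring
    rw [this]; exact mul_mem (mul_mem h2i hϑiO) (sub_mem htP htM)
  exact ⟨huP, hrP, hB, hS, hC, hT⟩


/-- **THE TRANSPORT OF THE CONGRUENCE (B5) ALONG THE GENUS TWIST.** `E′/ℚ` globally minimal, `Wd = C₂ • (D • E′)^{(d)}`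
globally minimal, `ℓ` an odd prime with `ℓ ∤ d·Δ_{E′}·Δ_{Wd}`; `L ⊇ ℚ` a field with two square roots `ϑ, ϑ′` of
`d` related by `ϑ = (d/ℓ)·ϑ′`; `e : L → Ω`, `𝒪` a valuation subring of `Ω` with `ℓ ∈ 𝔪_𝒪`. If `P ≡ Frob_ℓ(P₀)`
modulo `𝒪` on `E′` (coordinate predicate `FrobCongruentModPlace`), then `Θ_ϑ(P) ≡ Frob_ℓ(Θ_{ϑ′}(P₀))` modulo `𝒪` on
`Wd`. Proof: at the place `O = 𝒪 ∩ L`, `Θ_θ = T_θ` is the substitution `(x, y) ↦ (A⁻²θ²(x − R), A⁻³θ³(y −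
(Bθ + S)(x − R) − Cθ − T₀))` with `ℓ`-integral rationals `A^{±1}, R, B, S, C, T₀` (`twistChange_integral`), whose
residues are Frobenius-fixed, while `ϑ̄′^ℓ = (d/ℓ)ϑ̄′ = ϑ̄` (Euler); so Frobenius carries the residue of
`T_{ϑ′}(x₀, y₀)` to that of `T_ϑ(x, y)` when it carries `(x̄₀, ȳ₀)` to `(x̄, ȳ)`, and non-integral `x` stay
non-integral. This is the sign `χ_{d₁}(ℓ)` of lead report 4 §2 ((B5): "`θ̄^ℓ = χ_{d₁}(ℓ)θ̄` cancels").
[cite: SilvermanAEC2009, VII.2 Prop. 2.1, VII.1 Prop. 1.3 (b), X.5 Cor. 5.4 (iii)] [cite: GrossLMS1991, Prop. 3.7 (2)] -/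
theorem frobCongruentModPlace_twist [CharZero L] [(D • E').IsCharNeTwoNF]
    [(C₂ • (D • E').quadraticTwist (d : ℚ)).IsGloballyMinimal]
    {ℓ : ℕ} [Fact ℓ.Prime] (hℓ2 : ℓ ≠ 2) (hℓd : ¬ (ℓ : ℤ) ∣ d)
    (hℓE : ¬ (ℓ : ℤ) ∣ minimalDiscriminantInt E')
    (hℓW : ¬ (ℓ : ℤ) ∣ minimalDiscriminantInt (C₂ • (D • E').quadraticTwist (d : ℚ)))
    {ϑ ϑ' : L} (hϑ2 : ϑ ^ 2 = algebraMap ℚ L (d : ℚ)) (hϑ : ϑ ≠ 0)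
    (hϑ'2 : ϑ' ^ 2 = algebraMap ℚ L (d : ℚ)) (hϑ' : ϑ' ≠ 0)
    (hsign : ϑ = ((legendreSym ℓ d : ℤ) : L) * ϑ')
    {Ω : Type*} [Field Ω] (e : L →+* Ω) (𝒪 : ValuationSubring Ω) (hℓ𝒪 : (ℓ : Ω) ∈ 𝒪.nonunits)
    {P P₀ : (E'.baseChange L).toAffine.Point}
    (h : FrobCongruentModPlace 𝒪 ℓ ((E'.baseChange L).mapPointHom e P)
      ((E'.baseChange L).mapPointHom e P₀)) :
    FrobCongruentModPlace 𝒪 ℓ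
      (((C₂ • (D • E').quadraticTwist (d : ℚ)).baseChange L).mapPointHom e
        (VariableChange.pointEquivBaseChange ((D • E').quadraticTwist (d : ℚ)) C₂ L
          (((D • E').untwistEquivAt hϑ2 hϑ).symm (VariableChange.pointEquivBaseChange E' D L P))))
      (((C₂ • (D • E').quadraticTwist (d : ℚ)).baseChange L).mapPointHom e
        (VariableChange.pointEquivBaseChange ((D • E').quadraticTwist (d : ℚ)) C₂ L
          (((D • E').untwistEquivAt hϑ'2 hϑ').symm (VariableChange.pointEquivBaseChange E' D L P₀)))) := by
  have hℓ : ℓ.Prime := Fact.out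
  set O := 𝒪.comap e with hOdef
  have hℓO : (ℓ : L) ∈ O.nonunits := by
    rw [hOdef, mem_nonunits_comap_iff, map_natCast]; exact hℓ𝒪
  rw [frobCongruentModPlace_mapPointHom_iff] at h ⊢
  haveI := charP_residueField O hℓ hℓO
  haveI : ExpChar (ResidueField O) ℓ := ExpChar.prime hℓ
  -- the rational coefficients and their integrality
  obtain ⟨hvA, hRO, hBO, hSO, hCO, hTO⟩ :=
    twistChange_integral (E' := E') (D := D) (C₂ := C₂) (d := d) O hℓ2 hℓO hℓd hℓE hℓW hϑ'2 hϑ'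
  set A : L := algebraMap ℚ L ((C₂.u : ℚ) * D.u) with hAdef
  set R : L := algebraMap ℚ L (C₂.r * (D.u : ℚ) ^ 2 / d + D.r) with hRdef
  set B : L := algebraMap ℚ L ((D.u : ℚ) * C₂.s / d) with hBdef
  set S : L := algebraMap ℚ L D.s with hSdef
  set Cc : L := algebraMap ℚ L (C₂.t * (D.u : ℚ) ^ 3 / d ^ 2) with hCdef
  set T₀ : L := algebraMap ℚ L (C₂.r * D.s * (D.u : ℚ) ^ 2 / d + D.t) with hTdef
  have hA0 : A ≠ 0 := fun h0 => by rw [h0, map_zero] at hvA; exact zero_ne_one hvA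
  have hAO : A ∈ O := (O.valuation_le_one_iff _).mp hvA.le
  have hAiO : A⁻¹ ∈ O := (O.valuation_le_one_iff _).mp (by rw [map_inv₀, hvA, inv_one])
  have hϑ2' : ϑ ^ 2 = (d : L) := by rw [hϑ2, map_intCast]
  have hϑ'2' : ϑ' ^ 2 = (d : L) := by rw [hϑ'2, map_intCast]
  have hϑO : ϑ ∈ O := sqrt_mem O hℓO hℓd hϑ2'
  have hϑ'O : ϑ' ∈ O := sqrt_mem O hℓO hℓd hϑ'2'
  have hϑiO : ϑ⁻¹ ∈ O := sqrt_inv_mem O hℓO hℓd hϑ2'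
  have hϑ'iO : ϑ'⁻¹ ∈ O := sqrt_inv_mem O hℓO hℓd hϑ'2'
  -- the substitution formulas, uniformly in the root
  have hXY : ∀ {θ : L} (hθ2 : θ ^ 2 = algebraMap ℚ L (d : ℚ)) (hθ : θ ≠ 0) (x y : L),
      (C₂.map (algebraMap ℚ L) * ((untwistAt hθ)⁻¹ * D.map (algebraMap ℚ L))).toX x =
        A⁻¹ ^ 2 * θ ^ 2 * (x - R) ∧
      (C₂.map (algebraMap ℚ L) * ((untwistAt hθ)⁻¹ * D.map (algebraMap ℚ L))).toY x y =
        A⁻¹ ^ 3 * θ ^ 3 * (y - (B * θ + S) * (x - R) - (Cc * θ + T₀)) := by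
    intro θ hθ2 hθ x y
    obtain ⟨cu, cr, cs, ct⟩ := twistChange_coeff D C₂ d hθ2 hθ
    refine ⟨?_, ?_⟩
    · rw [VariableChange.toX_def, Units.val_inv_eq_inv_val, cu, cr, mul_inv, inv_inv]
      ring
    · rw [VariableChange.toY_def, Units.val_inv_eq_inv_val, cu, cr, cs, ct, mul_inv, inv_inv]
      ring
  -- residues
  have hrat : ∀ (z : L) (hz : z ∈ O) (q : ℚ), z = algebraMap ℚ L q →
      residue O ⟨z, hz⟩ ^ ℓ = residue O ⟨z, hz⟩ := by
    rintro z hz q rfl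
    have hq : (q : L) ∈ O := by rwa [eq_ratCast] at hz
    have := residue_ratCast_pow_eq O hℓ hℓO q hq
    have e1 : (⟨algebraMap ℚ L q, hz⟩ : O) = ⟨(q : L), hq⟩ := Subtype.ext (eq_ratCast _ q)
    rw [e1]; exact this
  have hφAi := hrat A⁻¹ hAiO (((C₂.u : ℚ) * D.u)⁻¹) (by rw [hAdef, map_inv₀])
  have hφR := hrat R hRO _ hRdef
  have hφB := hrat B hBO _ hBdef
  have hφS := hrat S hSO _ hSdef
  have hφC := hrat Cc hCO _ hCdef
  have hφT := hrat T₀ hTO _ hTdef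
  have hφϑ' := residue_sqrt_pow O hℓO hℓd hϑ'2' hℓ2
  have hdz : ((d : ℤ) : ZMod ℓ) ≠ 0 := by
    rwa [Ne, ZMod.intCast_zmod_eq_zero_iff_dvd]
  have hw2 : (((legendreSym ℓ d : ℤ) : ResidueField O)) ^ 2 = 1 := by
    rw [← Int.cast_pow, legendreSym.sq_one ℓ hdz, Int.cast_one]
  have hw3 : (((legendreSym ℓ d : ℤ) : ResidueField O)) ^ 3 = ((legendreSym ℓ d : ℤ) : ResidueField O) := by
    rw [pow_succ, hw2, one_mul]
  have hϑϑ' : residue O ⟨ϑ, hϑO⟩ = ((legendreSym ℓ d : ℤ) : ResidueField O) * residue O ⟨ϑ', hϑ'O⟩ := by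
    rw [← map_intCast (residue O), ← map_mul]
    congr 1
    exact Subtype.ext (by simp [hsign])
  -- Frobenius on the residues of the two substitutions
  have hφX : ∀ {x x₀ : L} (hx : x ∈ O) (hx₀ : x₀ ∈ O),
      residue O ⟨x₀, hx₀⟩ ^ ℓ = residue O ⟨x, hx⟩ →
      residue O ⟨A⁻¹ ^ 2 * ϑ' ^ 2 * (x₀ - R), mul_mem (mul_mem (pow_mem hAiO 2) (pow_mem hϑ'O 2))
          (sub_mem hx₀ hRO)⟩ ^ ℓ =
        residue O ⟨A⁻¹ ^ 2 * ϑ ^ 2 * (x - R), mul_mem (mul_mem (pow_mem hAiO 2) (pow_mem hϑO 2))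
          (sub_mem hx hRO)⟩ := by
    intro x x₀ hx hx₀ hxx
    have e0 : (⟨A⁻¹ ^ 2 * ϑ' ^ 2 * (x₀ - R), mul_mem (mul_mem (pow_mem hAiO 2) (pow_mem hϑ'O 2))
        (sub_mem hx₀ hRO)⟩ : O) = ⟨A⁻¹, hAiO⟩ ^ 2 * ⟨ϑ', hϑ'O⟩ ^ 2 * (⟨x₀, hx₀⟩ - ⟨R, hRO⟩) :=
      Subtype.ext rfl
    have e1 : (⟨A⁻¹ ^ 2 * ϑ ^ 2 * (x - R), mul_mem (mul_mem (pow_mem hAiO 2) (pow_mem hϑO 2))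
        (sub_mem hx hRO)⟩ : O) = ⟨A⁻¹, hAiO⟩ ^ 2 * ⟨ϑ, hϑO⟩ ^ 2 * (⟨x, hx⟩ - ⟨R, hRO⟩) :=
      Subtype.ext rfl
    rw [e0, e1, map_mul, map_mul, map_pow, map_pow, map_sub, map_mul, map_mul, map_pow, map_pow,
      map_sub, ← frobenius_def (p := ℓ), map_mul, map_mul, map_sub, map_pow, map_pow]
    simp only [frobenius_def]
    rw [hφAi, hφϑ', hxx, hφR, hϑϑ', mul_pow _ _ 2, hw2, one_mul]
  have hφY : ∀ {x y x₀ y₀ : L} (hx : x ∈ O) (hy : y ∈ O) (hx₀ : x₀ ∈ O) (hy₀ : y₀ ∈ O),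
      residue O ⟨x₀, hx₀⟩ ^ ℓ = residue O ⟨x, hx⟩ → residue O ⟨y₀, hy₀⟩ ^ ℓ = residue O ⟨y, hy⟩ →
      residue O ⟨A⁻¹ ^ 3 * ϑ' ^ 3 * (y₀ - (B * ϑ' + S) * (x₀ - R) - (Cc * ϑ' + T₀)),
          mul_mem (mul_mem (pow_mem hAiO 3) (pow_mem hϑ'O 3)) (sub_mem (sub_mem hy₀
            (mul_mem (add_mem (mul_mem hBO hϑ'O) hSO) (sub_mem hx₀ hRO))) (add_mem (mul_mem hCO hϑ'O) hTO))⟩ ^ ℓ =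
        residue O ⟨A⁻¹ ^ 3 * ϑ ^ 3 * (y - (B * ϑ + S) * (x - R) - (Cc * ϑ + T₀)),
          mul_mem (mul_mem (pow_mem hAiO 3) (pow_mem hϑO 3)) (sub_mem (sub_mem hy
            (mul_mem (add_mem (mul_mem hBO hϑO) hSO) (sub_mem hx hRO))) (add_mem (mul_mem hCO hϑO) hTO))⟩ := by
    intro x y x₀ y₀ hx hy hx₀ hy₀ hxx hyy
    have e0 : (⟨A⁻¹ ^ 3 * ϑ' ^ 3 * (y₀ - (B * ϑ' + S) * (x₀ - R) - (Cc * ϑ' + T₀)),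
          mul_mem (mul_mem (pow_mem hAiO 3) (pow_mem hϑ'O 3)) (sub_mem (sub_mem hy₀
            (mul_mem (add_mem (mul_mem hBO hϑ'O) hSO) (sub_mem hx₀ hRO))) (add_mem (mul_mem hCO hϑ'O) hTO))⟩ : O) =
        ⟨A⁻¹, hAiO⟩ ^ 3 * ⟨ϑ', hϑ'O⟩ ^ 3 * (⟨y₀, hy₀⟩ - (⟨B, hBO⟩ * ⟨ϑ', hϑ'O⟩ + ⟨S, hSO⟩) *
          (⟨x₀, hx₀⟩ - ⟨R, hRO⟩) - (⟨Cc, hCO⟩ * ⟨ϑ', hϑ'O⟩ + ⟨T₀, hTO⟩)) :=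
      Subtype.ext rfl
    have e1 : (⟨A⁻¹ ^ 3 * ϑ ^ 3 * (y - (B * ϑ + S) * (x - R) - (Cc * ϑ + T₀)),
          mul_mem (mul_mem (pow_mem hAiO 3) (pow_mem hϑO 3)) (sub_mem (sub_mem hy
            (mul_mem (add_mem (mul_mem hBO hϑO) hSO) (sub_mem hx hRO))) (add_mem (mul_mem hCO hϑO) hTO))⟩ : O) =
        ⟨A⁻¹, hAiO⟩ ^ 3 * ⟨ϑ, hϑO⟩ ^ 3 * (⟨y, hy⟩ - (⟨B, hBO⟩ * ⟨ϑ, hϑO⟩ + ⟨S, hSO⟩) *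
          (⟨x, hx⟩ - ⟨R, hRO⟩) - (⟨Cc, hCO⟩ * ⟨ϑ, hϑO⟩ + ⟨T₀, hTO⟩)) :=
      Subtype.ext rfl
    rw [e0, e1]
    simp only [map_mul, map_pow, map_sub, map_add]
    rw [← frobenius_def (p := ℓ)]
    simp only [map_mul, map_pow, map_sub, map_add]
    simp only [frobenius_def]
    rw [hφAi, hφϑ', hxx, hyy, hφR, hφB, hφS, hφC, hφT, hϑϑ', mul_pow _ _ 3, hw3]
  -- non-integral `x` stay non-integral
  have hnot : ∀ {θ : L} (_ : θ ≠ 0) (_ : θ⁻¹ ∈ O) {x : L}, x ∉ O → A⁻¹ ^ 2 * θ ^ 2 * (x - R) ∉ O := by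
    intro θ hθ0 hθi x hx hX
    apply hx
    have : x = A ^ 2 * θ⁻¹ ^ 2 * (A⁻¹ ^ 2 * θ ^ 2 * (x - R)) + R := by
      field_simp
      ring
    rw [this]
    exact add_mem (mul_mem (mul_mem (pow_mem hAO 2) (pow_mem hθi 2)) hX) hRO
  -- the case analysis
  rcases P with _ | ⟨x, y, hxy⟩ <;> rcases P₀ with _ | ⟨x₀, y₀, hxy₀⟩
  · simp only [← Affine.Point.zero_def, map_zero, frobCongruentModPlace_zero_zero]
  · obtain ⟨h2, e2⟩ := twist_some E' D C₂ d hϑ'2 hϑ' hxy₀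
    obtain ⟨eX₀, -⟩ := hXY hϑ'2 hϑ' x₀ y₀
    rw [← Affine.Point.zero_def, frobCongruentModPlace_zero_some] at h
    rw [← Affine.Point.zero_def, map_zero, map_zero, map_zero, e2, frobCongruentModPlace_zero_some, eX₀]
    exact hnot hϑ' hϑ'iO h
  · obtain ⟨h1, e1⟩ := twist_some E' D C₂ d hϑ2 hϑ hxy
    obtain ⟨eX, -⟩ := hXY hϑ2 hϑ x y
    rw [← Affine.Point.zero_def, frobCongruentModPlace_some_zero] at h
    rw [← Affine.Point.zero_def, map_zero, map_zero, map_zero, e1, frobCongruentModPlace_some_zero, eX]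
    exact hnot hϑ hϑiO h
  · obtain ⟨h1, e1⟩ := twist_some E' D C₂ d hϑ2 hϑ hxy
    obtain ⟨h2, e2⟩ := twist_some E' D C₂ d hϑ'2 hϑ' hxy₀
    obtain ⟨eX, eY⟩ := hXY hϑ2 hϑ x y
    obtain ⟨eX₀, eY₀⟩ := hXY hϑ'2 hϑ' x₀ y₀
    rw [frobCongruentModPlace_some_some] at h
    rw [e1, e2, frobCongruentModPlace_some_some, eX, eY, eX₀, eY₀]
    rcases h with ⟨hx, hx₀⟩ | ⟨hx, hy, hx₀, hy₀, hxx, hyy⟩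
    · exact Or.inl ⟨hnot hϑ hϑiO hx, hnot hϑ' hϑ'iO hx₀⟩
    · right
      have hX : A⁻¹ ^ 2 * ϑ ^ 2 * (x - R) ∈ O :=
        mul_mem (mul_mem (pow_mem hAiO 2) (pow_mem hϑO 2)) (sub_mem hx hRO)
      have hX₀ : A⁻¹ ^ 2 * ϑ' ^ 2 * (x₀ - R) ∈ O :=
        mul_mem (mul_mem (pow_mem hAiO 2) (pow_mem hϑ'O 2)) (sub_mem hx₀ hRO)
      have hY : A⁻¹ ^ 3 * ϑ ^ 3 * (y - (B * ϑ + S) * (x - R) - (Cc * ϑ + T₀)) ∈ O :=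
        mul_mem (mul_mem (pow_mem hAiO 3) (pow_mem hϑO 3)) (sub_mem (sub_mem hy
          (mul_mem (add_mem (mul_mem hBO hϑO) hSO) (sub_mem hx hRO))) (add_mem (mul_mem hCO hϑO) hTO))
      have hY₀ : A⁻¹ ^ 3 * ϑ' ^ 3 * (y₀ - (B * ϑ' + S) * (x₀ - R) - (Cc * ϑ' + T₀)) ∈ O :=
        mul_mem (mul_mem (pow_mem hAiO 3) (pow_mem hϑ'O 3)) (sub_mem (sub_mem hy₀
          (mul_mem (add_mem (mul_mem hBO hϑ'O) hSO) (sub_mem hx₀ hRO))) (add_mem (mul_mem hCO hϑ'O) hTO))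
      have hxx' : residue O ⟨x₀, hx₀⟩ ^ ℓ = residue O ⟨x, hx⟩ := by
        rw [← map_pow, SubmonoidClass.mk_pow]
        exact ((sub_mem_nonunits_iff_residue_eq O hx (pow_mem hx₀ ℓ)).mp hxx).symm
      have hyy' : residue O ⟨y₀, hy₀⟩ ^ ℓ = residue O ⟨y, hy⟩ := by
        rw [← map_pow, SubmonoidClass.mk_pow]
        exact ((sub_mem_nonunits_iff_residue_eq O hy (pow_mem hy₀ ℓ)).mp hyy).symm
      refine ⟨hX, hY, hX₀, hY₀, ?_, ?_⟩
      · rw [sub_mem_nonunits_iff_residue_eq O hX (pow_mem hX₀ ℓ), ← SubmonoidClass.mk_pow, map_pow]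
        exact (hφX hx hx₀ hxx').symm
      · rw [sub_mem_nonunits_iff_residue_eq O hY (pow_mem hY₀ ℓ), ← SubmonoidClass.mk_pow, map_pow]
        exact (hφY hx hy hx₀ hy₀ hxx' hyy').symm

end Main

end Summit.BirchSwinnertonDyer.BirchSwinnertonDyer.Theorems.GenusKolyvagin

end
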